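import Summits.ValiantsHypothesis.ValiantsHypothesis.Theses.SymPencil
import Summits.ValiantsHypothesis.ValiantsHypothesis.Theses.ProofCarryingSymmetry
import Literature.Computability.AlgebraicComplexity.DawarWilsenach2025Thm71

/-!
# Birth skeleton — crux `SymPencil.EquivariantSdcNotQP` (item stmt-ValiantsHypothesis-17792)

Line PERMIFY-TO-DAWAR–WILSENACH (crux-strategist cstrat-5673, 2026-08-17).  The crux says: no
quasi-polynomial family of SYMMETRIC affine pencils for `per_n` that are EQUIVARIANT (exact linear
lifts, `IsEquivariantDetRepr`) for the row/column permutation pairs `Γ_n ≅ 𝔖_n × 𝔖_n`.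

Stubs (sorries ONLY here):
* `stub_permify` (L) — LINEAR LIFTS ⇒ PERMUTATION LIFTS at quasi-polynomial cost: normalise at the
  `Γ_n`-fixed point `J` (`per(J) = n! ≠ 0`) to conjugation-equivariance `B(γx) = g B(x) g⁻¹`, choose a
  finite lift group (a bounded central extension of `𝔖_n × 𝔖_n`), embed its representation
  isometrically into a permutation representation of dimension `≤ dim^{O(log n)}` (Young permutation
  modules for non-spin constituents; the regular representation for spin constituents, which have
  dimension `≥ 2^{(n-2)/2}` and so pay for it), extend `B` by the identity on the complement and
  rescale by `per(J)^{1/m'}`: an affine pencil `A'` with `det A' = per_n` and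
  `A'(x_{π i, ρ j}) = P_σ A'(x) P_σᵀ` for permutation matrices.
* `stub_toSymmetricCircuit` (M) — a conjugation-equivariant pencil with PERMUTATION lifts gives a
  diagonally `𝔖_n`-symmetric labelled circuit of polynomial size computing `per_n`: Dawar–Wilsenach's
  polynomial-size symmetric circuits for `det` (ToC 2025 Thm 4.1, Le Verrier; route
  ProofCarryingSymmetry.DetCalibration) composed with the equivariant affine input layer.
* Dawar–Wilsenach's lower bound — NOT a stub: `ProofCarryingSymmetry.SquareSymmetricPermLB` (item
  stmt-ValiantsHypothesis-10342, shared with this route; ToC 2025 Thm 7.1: `𝔖_n`-symmetric circuits for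
  `per_n` have size `2^{Ω(n)}` infinitely often) is PROVED in the tree
  (`DawarWilsenach2025_thm71_holds`) and discharged here (`squareSymmetricPermLB_holds`).

Composition `equivariantSdcNotQP_of` (kernel-checked, no sorry): qp ∘ qp ∘ poly is `2^{polylog n}`
(`qpBound_comp_qpBound`, `exp_bound`), and polylog is eventually below `ε n`
(`polylog_eventually_lt`, from Mathlib's `Real.tendsto_pow_log_div_mul_add_atTop`), contradicting
the `2^{ε n}` of Thm 7.1 along its infinitely many `n`.
-/

noncomputable section

-- single-conjunct layout: Sub = Summit, duplicated namespace component intended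
set_option linter.dupNamespace false

namespace Summit.ValiantsHypothesis.ValiantsHypothesis.Cruxes.EquivariantSdcNotQP.Birth

open Literature.Computability.AlgebraicComplexity MvPolynomial Matrix
open Summit.ValiantsHypothesis.ValiantsHypothesis.Theses

/-- `Γ_n`: the row/column permutation pairs as a subgroup of `GL(n², ℂ)` — the body used verbatim by
the route items `SymPencil.EquivariantSdcNotQP` / `SymPencil.SymmetrizePermPairs`. -/
abbrev permPairSubst (n : ℕ) : Subgroup (GL (Fin n × Fin n) ℂ) :=
  Subgroup.closure {γ : GL (Fin n × Fin n) ℂ | ∃ π ρ : Equiv.Perm (Fin n),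
    (γ : Matrix (Fin n × Fin n) (Fin n × Fin n) ℂ) = Equiv.Perm.permMatrix ℂ (Equiv.prodCongr π ρ)}

/-! ### Stubs -/

/-- **stub_permify** (L).  Linear lifts ⇒ permutation lifts, conjugation form, at quasi-polynomial
cost: a `Γ_n`-equivariant symmetric affine pencil of size `m` for `per_n` yields an affine pencil
`A'` of size `m' ≤ 2^{(log₂ m + d)^d}` with `det A' = per_n` such that every substitution
`x_{ij} ↦ x_{π i, ρ j}` is undone by CONJUGATION WITH A PERMUTATION MATRIX. -/
theorem stub_permify :
    ∃ d : ℕ, ∀ (n m : ℕ) (A : Matrix (Fin m) (Fin m) (MvPolynomial (Fin n × Fin n) ℂ)),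
      A.IsSymm → IsEquivariantDetRepr (permPairSubst n) (perPoly (Fin n) ℂ) A →
      ∃ m' ≤ 2 ^ ((Nat.log 2 m + d) ^ d),
        ∃ A' : Matrix (Fin m') (Fin m') (MvPolynomial (Fin n × Fin n) ℂ),
          IsAffineDetRepr (perPoly (Fin n) ℂ) A' ∧
          ∀ π ρ : Equiv.Perm (Fin n), ∃ σ : Equiv.Perm (Fin m'),
            A'.map (MvPolynomial.rename fun ij : Fin n × Fin n => (π ij.1, ρ ij.2)) =
              (σ.permMatrix ℂ).map MvPolynomial.C * A' * ((σ.permMatrix ℂ)ᵀ).map MvPolynomial.C := by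
  sorry

/-- **stub_toSymmetricCircuit** (M).  A pencil with `det = per_n` on which the diagonal
substitutions `x_{ij} ↦ x_{σ i, σ j}` act by conjugation with permutation matrices is computed —
together with Dawar–Wilsenach's polynomial-size `𝔖`-symmetric determinant circuits (ToC 2025
Thm 4.1) — by a diagonally `𝔖_n`-symmetric labelled circuit of size polynomial in its size. -/
theorem stub_toSymmetricCircuit :
    ∃ e : ℕ, ∀ (n m' : ℕ) (A' : Matrix (Fin m') (Fin m') (MvPolynomial (Fin n × Fin n) ℂ)),
      IsAffineDetRepr (perPoly (Fin n) ℂ) A' →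
      (∀ σ : Equiv.Perm (Fin n), ∃ τ : Equiv.Perm (Fin m'),
        A'.map (MvPolynomial.rename fun ij : Fin n × Fin n => (σ ij.1, σ ij.2)) =
          (τ.permMatrix ℂ).map MvPolynomial.C * A' * ((τ.permMatrix ℂ)ᵀ).map MvPolynomial.C) →
      ∃ (G : Type) (_ : Fintype G) (C : LabelledArithCircuit ℂ (Fin n × Fin n) Unit G),
        C.IsSymmetric (Equiv.Perm (Fin n)) ∧ C.eval (C.output ()) = perPoly (Fin n) ℂ ∧
          Fintype.card G ≤ (m' + 2) ^ e := by
  sorry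

/-! ### Arithmetic (proved) -/

/-- qp ∘ qp exponent bookkeeping: `((L + c)^c + d)^d ≤ (L + e)^e`, `e = (c+1)(d+1)`. [folklore] -/
theorem qpExp_comp (L c d : ℕ) :
    ((L + c) ^ c + d) ^ d ≤ (L + (c + 1) * (d + 1)) ^ ((c + 1) * (d + 1)) := by
  set a := L + c + d + 1 with ha
  have hac : (L + c) ^ c ≤ a ^ c := Nat.pow_le_pow_left (by omega) c
  have ha1 : 1 ≤ a ^ c := Nat.one_le_pow _ _ (by omega)
  have h1 : (L + c) ^ c + d ≤ a ^ (c + 1) := by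
    calc (L + c) ^ c + d ≤ a ^ c + d * a ^ c := by nlinarith
      _ = (d + 1) * a ^ c := by ring
      _ ≤ a * a ^ c := Nat.mul_le_mul_right _ (by omega)
      _ = a ^ (c + 1) := by ring
  have h2 : ((L + c) ^ c + d) ^ d ≤ (a ^ (c + 1)) ^ d := Nat.pow_le_pow_left h1 d
  have hcd : c + d + 1 ≤ (c + 1) * (d + 1) := by nlinarith
  have h4 : a ≤ L + (c + 1) * (d + 1) := by omega
  have h5 : a ^ ((c + 1) * d) ≤ (L + (c + 1) * (d + 1)) ^ ((c + 1) * d) :=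
    Nat.pow_le_pow_left h4 _
  have h6 : (L + (c + 1) * (d + 1)) ^ ((c + 1) * d) ≤
      (L + (c + 1) * (d + 1)) ^ ((c + 1) * (d + 1)) :=
    Nat.pow_le_pow_right (by nlinarith) (by nlinarith)
  calc ((L + c) ^ c + d) ^ d ≤ (a ^ (c + 1)) ^ d := h2
    _ = a ^ ((c + 1) * d) := by rw [← pow_mul]
    _ ≤ (L + (c + 1) * (d + 1)) ^ ((c + 1) * d) := h5
    _ ≤ (L + (c + 1) * (d + 1)) ^ ((c + 1) * (d + 1)) := h6

/-- qp ∘ qp in the route's shape. [folklore] -/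
theorem qpBound_comp_qpBound {n m c d : ℕ} (hm : m ≤ 2 ^ ((Nat.log 2 n + c) ^ c)) :
    2 ^ ((Nat.log 2 m + d) ^ d) ≤ 2 ^ ((Nat.log 2 n + (c + 1) * (d + 1)) ^ ((c + 1) * (d + 1))) := by
  apply Nat.pow_le_pow_right (by norm_num)
  have hlog : Nat.log 2 m ≤ (Nat.log 2 n + c) ^ c := by
    calc Nat.log 2 m ≤ Nat.log 2 (2 ^ ((Nat.log 2 n + c) ^ c)) := Nat.log_mono_right hm
      _ = (Nat.log 2 n + c) ^ c := Nat.log_pow one_lt_two _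
  calc (Nat.log 2 m + d) ^ d ≤ ((Nat.log 2 n + c) ^ c + d) ^ d := Nat.pow_le_pow_left (by omega) d
    _ ≤ _ := qpExp_comp _ c d

/-- Size bookkeeping: `(2^k + 2)^e ≤ 2^{e (L + c + 3)^{c+1}}` when `k = (L + c)^c`. [folklore] -/
theorem exp_bound (L c e : ℕ) :
    (2 ^ ((L + c) ^ c) + 2) ^ e ≤ 2 ^ (e * (L + c + 3) ^ (c + 1)) := by
  -- (L+c)^c + 2 ≤ (L+c+3)^(c+1)
  have hexp : (L + c) ^ c + 2 ≤ (L + c + 3) ^ (c + 1) := by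
    rcases c with _ | c
    · simp
    · set b := L + (c + 1) + 3 with hb
      have hb4 : 4 ≤ b := by omega
      have hk : (L + (c + 1)) ^ (c + 1) ≤ b ^ (c + 1) := Nat.pow_le_pow_left (by omega) _
      have hbb : b ≤ b ^ (c + 1) := by
        calc b = b ^ 1 := (pow_one b).symm
          _ ≤ b ^ (c + 1) := Nat.pow_le_pow_right (by omega) (by omega)
      calc (L + (c + 1)) ^ (c + 1) + 2 ≤ b ^ (c + 1) + b ^ (c + 1) := by omega
        _ = 2 * b ^ (c + 1) := by ring
        _ ≤ b * b ^ (c + 1) := Nat.mul_le_mul_right _ (by omega)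
        _ = b ^ (c + 1 + 1) := by ring
  -- 2^k + 2 ≤ 2^(k+2)
  have hstep : 2 ^ ((L + c) ^ c) + 2 ≤ 2 ^ ((L + c) ^ c + 2) := by
    have h1 : 1 ≤ 2 ^ ((L + c) ^ c) := Nat.one_le_two_pow
    calc 2 ^ ((L + c) ^ c) + 2 ≤ 4 * 2 ^ ((L + c) ^ c) := by omega
      _ = 2 ^ ((L + c) ^ c + 2) := by ring
  calc (2 ^ ((L + c) ^ c) + 2) ^ e ≤ (2 ^ ((L + c) ^ c + 2)) ^ e := Nat.pow_le_pow_left hstep e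
    _ = 2 ^ (((L + c) ^ c + 2) * e) := by rw [← pow_mul]
    _ ≤ 2 ^ ((L + c + 3) ^ (c + 1) * e) :=
        Nat.pow_le_pow_right (by norm_num) (Nat.mul_le_mul_right e hexp)
    _ = 2 ^ (e * (L + c + 3) ^ (c + 1)) := by rw [mul_comm]

/-- Polylog is eventually below any linear function: `(⌊log₂ n⌋ + K)^k < δ n` for `n ≥ N(k,K,δ)`.
[folklore; from `Real.tendsto_pow_log_div_mul_add_atTop`] -/
theorem polylog_eventually_lt (k K : ℕ) {δ : ℝ} (hδ : 0 < δ) :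
    ∃ N : ℕ, ∀ n ≥ N, ((Nat.log 2 n : ℝ) + K) ^ k < δ * n := by
  have ht := Real.tendsto_pow_log_div_mul_add_atTop 1 0 k one_ne_zero
  set M : ℝ := (2 / Real.log 2) ^ k with hM
  have hlog2 : 0 < Real.log 2 := Real.log_pos one_lt_two
  have hMpos : 0 < M := by positivity
  have hev : ∀ᶠ x : ℝ in Filter.atTop, Real.log x ^ k / (1 * x + 0) < δ / M :=
    ht.eventually_lt_const (by positivity)
  obtain ⟨X₀, hX₀⟩ := Filter.eventually_atTop.1 hev
  refine ⟨max (max ⌈X₀⌉₊ (2 ^ K)) 1, fun n hn => ?_⟩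
  have hn1 : 1 ≤ n := le_trans (le_max_right _ _) hn
  have hnX' : ⌈X₀⌉₊ ≤ n := le_trans (le_trans (le_max_left _ _) (le_max_left _ _)) hn
  have hnX : X₀ ≤ (n : ℝ) := le_trans (Nat.le_ceil X₀) (by exact_mod_cast hnX')
  have hnK : 2 ^ K ≤ n := le_trans (le_trans (le_max_right _ _) (le_max_left _ _)) hn
  have hnpos : (0 : ℝ) < n := by exact_mod_cast hn1
  -- (a) ⌊log₂ n⌋ ≤ log n / log 2
  have ha : (Nat.log 2 n : ℝ) ≤ Real.log n / Real.log 2 := by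
    rw [le_div_iff₀ hlog2]
    have h := Nat.pow_log_le_self 2 (show n ≠ 0 by omega)
    have h' : (2 : ℝ) ^ Nat.log 2 n ≤ n := by exact_mod_cast h
    calc (Nat.log 2 n : ℝ) * Real.log 2 = Real.log ((2 : ℝ) ^ Nat.log 2 n) := by
          rw [Real.log_pow]
      _ ≤ Real.log n := Real.log_le_log (by positivity) h'
  -- (b) K ≤ log n / log 2
  have hb : (K : ℝ) ≤ Real.log n / Real.log 2 := by
    rw [le_div_iff₀ hlog2]
    have h' : (2 : ℝ) ^ K ≤ n := by exact_mod_cast hnK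
    calc (K : ℝ) * Real.log 2 = Real.log ((2 : ℝ) ^ K) := by rw [Real.log_pow]
      _ ≤ Real.log n := Real.log_le_log (by positivity) h'
  have hc : (Nat.log 2 n : ℝ) + K ≤ 2 / Real.log 2 * Real.log n := by
    have : 2 / Real.log 2 * Real.log n = Real.log n / Real.log 2 + Real.log n / Real.log 2 := by ring
    rw [this]
    exact add_le_add ha hb
  have h0 : 0 ≤ (Nat.log 2 n : ℝ) + K := by positivity
  have hd : ((Nat.log 2 n : ℝ) + K) ^ k ≤ M * Real.log n ^ k := by
    calc ((Nat.log 2 n : ℝ) + K) ^ k ≤ (2 / Real.log 2 * Real.log n) ^ k := pow_le_pow_left₀ h0 hc k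
      _ = M * Real.log n ^ k := by rw [mul_pow]
  have he : Real.log n ^ k < δ / M * n := by
    have := hX₀ n hnX
    rw [one_mul, add_zero, div_lt_iff₀ hnpos] at this
    exact this
  calc ((Nat.log 2 n : ℝ) + K) ^ k ≤ M * Real.log n ^ k := hd
    _ < M * (δ / M * n) := mul_lt_mul_of_pos_left he hMpos
    _ = δ * n := by field_simp

/-! ### Composition: the stubs conclude the crux BY NAME -/

/-- Dawar–Wilsenach's lower bound is PROVED in the tree (`DawarWilsenach2025_thm71_holds`,
Literature/Computability/AlgebraicComplexity/DawarWilsenach2025Thm71.lean): the shared obligation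
`ProofCarryingSymmetry.SquareSymmetricPermLB` (item stmt-ValiantsHypothesis-10342, also wanted by
SymPencil) is discharged in one line by its size form at `F = ℂ`. -/
theorem squareSymmetricPermLB_holds : ProofCarryingSymmetry.SquareSymmetricPermLB :=
  fun G _ C hs hp => DawarWilsenach2025_thm71.size_form DawarWilsenach2025_thm71_holds ℂ G C hs hp


/-- **`EquivariantSdcNotQP` from the stubs.**  A qp family of `Γ_n`-equivariant symmetric pencils
⇒ (permify) qp pencils with permutation lifts ⇒ (toSymmetricCircuit) `𝔖_n`-symmetric circuits of
size `2^{polylog n}` for every `n` ⇒ contradiction with Dawar–Wilsenach's `2^{ε n}` infinitely often. -/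
theorem equivariantSdcNotQP_of
    (h₁ : ∃ d : ℕ, ∀ (n m : ℕ) (A : Matrix (Fin m) (Fin m) (MvPolynomial (Fin n × Fin n) ℂ)),
      A.IsSymm → IsEquivariantDetRepr (permPairSubst n) (perPoly (Fin n) ℂ) A →
      ∃ m' ≤ 2 ^ ((Nat.log 2 m + d) ^ d),
        ∃ A' : Matrix (Fin m') (Fin m') (MvPolynomial (Fin n × Fin n) ℂ),
          IsAffineDetRepr (perPoly (Fin n) ℂ) A' ∧
          ∀ π ρ : Equiv.Perm (Fin n), ∃ σ : Equiv.Perm (Fin m'),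
            A'.map (MvPolynomial.rename fun ij : Fin n × Fin n => (π ij.1, ρ ij.2)) =
              (σ.permMatrix ℂ).map MvPolynomial.C * A' * ((σ.permMatrix ℂ)ᵀ).map MvPolynomial.C)
    (h₂ : ∃ e : ℕ, ∀ (n m' : ℕ) (A' : Matrix (Fin m') (Fin m') (MvPolynomial (Fin n × Fin n) ℂ)),
      IsAffineDetRepr (perPoly (Fin n) ℂ) A' →
      (∀ σ : Equiv.Perm (Fin n), ∃ τ : Equiv.Perm (Fin m'),
        A'.map (MvPolynomial.rename fun ij : Fin n × Fin n => (σ ij.1, σ ij.2)) =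
          (τ.permMatrix ℂ).map MvPolynomial.C * A' * ((τ.permMatrix ℂ)ᵀ).map MvPolynomial.C) →
      ∃ (G : Type) (_ : Fintype G) (C : LabelledArithCircuit ℂ (Fin n × Fin n) Unit G),
        C.IsSymmetric (Equiv.Perm (Fin n)) ∧ C.eval (C.output ()) = perPoly (Fin n) ℂ ∧
          Fintype.card G ≤ (m' + 2) ^ e) :
    -- the BODY of `SymPencil.EquivariantSdcNotQP` (so that only `EquivariantSdcNotQP_of` below concludes
    -- the crux by name, as the skeleton audit requires; the two agree by `Iff.rfl`)
    ¬ ∃ c : ℕ, ∀ n : ℕ, ∃ m ≤ 2 ^ ((Nat.log 2 n + c) ^ c),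
      ∃ A : Matrix (Fin m) (Fin m) (MvPolynomial (Fin n × Fin n) ℂ), A.IsSymm ∧
        IsEquivariantDetRepr (permPairSubst n) (perPoly (Fin n) ℂ) A := by
  have h₃ : ProofCarryingSymmetry.SquareSymmetricPermLB := squareSymmetricPermLB_holds
  rintro ⟨c, hc⟩
  obtain ⟨d, hd⟩ := h₁
  obtain ⟨e, he⟩ := h₂
  set c' : ℕ := (c + 1) * (d + 1) with hc'
  -- Step 1: symmetric circuits of size 2^{e (log₂ n + c' + 3)^{c'+1}} for every n
  have key : ∀ n : ℕ, ∃ (G : Type) (_ : Fintype G) (C : LabelledArithCircuit ℂ (Fin n × Fin n) Unit G),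
      C.IsSymmetric (Equiv.Perm (Fin n)) ∧ C.eval (C.output ()) = perPoly (Fin n) ℂ ∧
        Fintype.card G ≤ 2 ^ (e * (Nat.log 2 n + c' + 3) ^ (c' + 1)) := by
    intro n
    obtain ⟨m, hm, A, hAs, hA⟩ := hc n
    obtain ⟨m', hm', A', hA', hperm⟩ := hd n m A hAs hA
    obtain ⟨G, hG, C, hCs, hCe, hcard⟩ := he n m' A' hA' (fun σ => hperm σ σ)
    refine ⟨G, hG, C, hCs, hCe, hcard.trans ?_⟩
    have hm'' : m' ≤ 2 ^ ((Nat.log 2 n + c') ^ c') := hm'.trans (qpBound_comp_qpBound hm)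
    calc (m' + 2) ^ e ≤ (2 ^ ((Nat.log 2 n + c') ^ c') + 2) ^ e := Nat.pow_le_pow_left (by omega) e
      _ ≤ 2 ^ (e * (Nat.log 2 n + c' + 3) ^ (c' + 1)) := exp_bound _ c' e
  choose G hG C hCs hCe hcard using key
  obtain ⟨ε, hε, hio⟩ := @h₃ G hG C hCs hCe
  -- Step 2: the exponent is polylog, eventually below ε n
  have hδ : (0 : ℝ) < ε / (e + 1) := by positivity
  obtain ⟨N, hN⟩ := polylog_eventually_lt (c' + 1) (c' + 3) hδ
  obtain ⟨n, hn, hbig⟩ := hio N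
  have h1 := hN n hn
  have hnpos : (0 : ℝ) < n := by
    by_contra h0
    push Not at h0
    have hz : (n : ℝ) = 0 := le_antisymm h0 (Nat.cast_nonneg n)
    rw [hz, mul_zero] at h1
    exact absurd h1 (not_lt.2 (by positivity))
  have he0 : (0 : ℝ) ≤ e := Nat.cast_nonneg e
  have h1' : (e : ℝ) * (((Nat.log 2 n + c' + 3 : ℕ) : ℝ)) ^ (c' + 1) ≤ (e : ℝ) * (ε / (e + 1) * n) := by
    have heq : (((Nat.log 2 n + c' + 3 : ℕ) : ℝ)) = (Nat.log 2 n : ℝ) + ((c' + 3 : ℕ) : ℝ) := by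
      push_cast; ring
    rw [heq]
    exact mul_le_mul_of_nonneg_left h1.le he0
  have hexpR : ((e * (Nat.log 2 n + c' + 3) ^ (c' + 1) : ℕ) : ℝ) < ε * n := by
    rw [Nat.cast_mul, Nat.cast_pow]
    calc (e : ℝ) * (((Nat.log 2 n + c' + 3 : ℕ) : ℝ)) ^ (c' + 1) ≤ (e : ℝ) * (ε / (e + 1) * n) := h1'
      _ = (e / (e + 1)) * (ε * n) := by ring
      _ < 1 * (ε * n) := by
          apply mul_lt_mul_of_pos_right _ (by positivity)
          rw [div_lt_one (by positivity)]
          linarith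
      _ = ε * n := one_mul _
  -- Step 3: 2^{ε n} ≤ |C_n| ≤ 2^{exponent} forces ε n ≤ exponent, contradiction
  have hsizeR : (Fintype.card (G n) : ℝ) ≤
      (2 : ℝ) ^ (((e * (Nat.log 2 n + c' + 3) ^ (c' + 1) : ℕ)) : ℝ) := by
    rw [Real.rpow_natCast]
    exact_mod_cast hcard n
  have hchain := (Real.rpow_le_rpow_left_iff one_lt_two).1 (hbig.trans hsizeR)
  linarith

/-- **Registered composition** (`<CruxDecl>_of` shape for `ledger skeleton check`): the crux BY NAME
from the two declared stubs used directly (the only `sorry`s in its cone are theirs); the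
Dawar–Wilsenach anchor is a tree theorem, discharged inside.  `equivariantSdcNotQP_of` above is the
sorry-free certificate of the same composition with the stub statements as explicit hypotheses. -/
theorem EquivariantSdcNotQP_of : SymPencil.EquivariantSdcNotQP :=
  equivariantSdcNotQP_of stub_permify stub_toSymmetricCircuit

/-- The certificate's conclusion is the crux verbatim. -/
example : SymPencil.EquivariantSdcNotQP ↔
    ¬ ∃ c : ℕ, ∀ n : ℕ, ∃ m ≤ 2 ^ ((Nat.log 2 n + c) ^ c),
      ∃ A : Matrix (Fin m) (Fin m) (MvPolynomial (Fin n × Fin n) ℂ), A.IsSymm ∧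
        IsEquivariantDetRepr (permPairSubst n) (perPoly (Fin n) ℂ) A := Iff.rfl

end Summit.ValiantsHypothesis.ValiantsHypothesis.Cruxes.EquivariantSdcNotQP.Birth
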